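import Summits.HubbardSuperconductivity.HubbardSuperconductivity.Theorems.NoGoNogoThesis
import Literature.MathematicalPhysics.QuantumLattice.PairChirality
import Literature.MathematicalPhysics.QuantumLattice.SectorSpectrum

/-!
# `TwTipContinuation` (stmt-HubbardSuperconductivity-1700) — negative-side SUPPORT: the seeded family
`H_L(U,g) = hubbardTorus 2 L 1 U − (g/L²)(pairField d L)ᴴ(pairField d L)` at finite `L`

Sorry-free finite-dimensional facts extracted from the standing disprover's work file
`Cruxes/TwTipContinuation/Disproof.lean` (gen 2), for import by provers of the route `ThermalWedge`
(the glue items `TwRungGlue` / `TwCeilingGlue` use exactly these chords) and by ideators/planners: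

* `seededH_isHermitian`, `preservesSectors_seededH`, `seeded_sector_groundState`,
  `exists_unit_groundState`: the seeded Hamiltonian is Hermitian and `(N↑,N↓)`-block-diagonal, so
  normalised sector ground states exist in every sector `(2n, S^z = 0)`, `n ≤ L²`, and the sector
  energy `minEnergyOn` is a variational lower bound on the sector;
* `expect_pairIntensity_mono`: for `g₁ < g₂` every normalised sector ground state at `g₂` has at
  least the pair intensity `re⟨ψ,P_Lψ⟩` of every one at `g₁` (sum of two variational inequalities);
* `leftChord_le_order`, `order_le_rightChord`: the every-GS pair intensity at seed `g` is pinned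
  between the left and right difference quotients of `g ↦ E_L(g) = minEnergyOn(H_L(U,g), sector)`;
  `sectorEnergy_antitone`, `chord_slope_mono` (antitone, chord-concave profile).

All statements are folklore linear algebra (Tasaki 2020 §2.1–2.2 variational principle; concavity of
the ground-state energy in a linear coupling). Vocabulary: `((pairField dWaveFormFactor L`,)ᴴ * pairField dWaveFormFactor L`,) `H[U, g, L`,]
`(Matrix.minEnergyOn (hubbardTorus 2 L 1 U - ((g / (L : ℝ) ^ 2 : ℝ) : ℂ) • ((pairField dWaveFormFactor L)ᴴ * pairField dWaveFormFactor L)) (szSector (2 * n`) 0)) are reducible abbreviations of the literal route terms.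
-/

noncomputable section

namespace Summit.HubbardSuperconductivity.TwTipContinuation.Negative

open Matrix Filter Finset
open Literature.MathematicalPhysics.QuantumLattice Literature.Probability.LatticeModels
open scoped ComplexOrder

section Seeded

variable (U g : ℝ) (L : ℕ) [NeZero L]

/-- `P_L ≥ 0`. [folklore] -/
theorem pairIntensity_posSemidef : (((pairField dWaveFormFactor L)ᴴ * pairField dWaveFormFactor L)).PosSemidef :=
  pairField_conjTranspose_mul_self_posSemidef dWaveFormFactor L

/-- `re ⟨ψ, P_L ψ⟩ = ‖Δ ψ‖² ≥ 0`. [folklore] -/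
theorem expect_pairIntensity_nonneg (ψ : Fock (Orb (FermionTorus 2 L))) :
    0 ≤ (expect (((pairField dWaveFormFactor L)ᴴ * pairField dWaveFormFactor L)) ψ).re := by
  rw [PosSemidefTrace.expect_conjTranspose_mul, ← norm_toLp_sq_eq_re]
  positivity

/-- `H_L(U,g)` is Hermitian (real seed). [folklore] -/
theorem seededH_isHermitian : ((hubbardTorus 2 L 1 U - ((g / (L : ℝ) ^ 2 : ℝ) : ℂ) • ((pairField dWaveFormFactor L)ᴴ * pairField dWaveFormFactor L))).IsHermitian := by
  have h1 : (hubbardTorus 2 L 1 U).IsHermitian := LiebThm1.hamiltonian_isHermitian _ 1 U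
  have h2 : (((pairField dWaveFormFactor L)ᴴ * pairField dWaveFormFactor L)).IsHermitian := (pairIntensity_posSemidef L).isHermitian
  refine h1.sub ?_
  unfold Matrix.IsHermitian
  rw [conjTranspose_smul, h2.eq, Complex.star_def, Complex.conj_ofReal]

/-- `pairField` lowers `(N↑, N↓)` by `(1, 1)`. [folklore] -/
theorem shifts_pairField (g' : Site 2 → ℝ) : PairChirality.Shifts (-1) (-1) (pairField g' L) :=
  PairChirality.Shifts.sum fun x _ => PairChirality.shifts_localPair L g' x

/-- `P_L` conserves `N↑` and `N↓`. [folklore] -/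
theorem preservesSectors_pairIntensity : PreservesSectors (((pairField dWaveFormFactor L)ᴴ * pairField dWaveFormFactor L)) := by
  have h := (shifts_pairField L dWaveFormFactor).conjTranspose.mul (shifts_pairField L dWaveFormFactor)
  simp only [Int.reduceNeg, neg_neg, add_neg_cancel] at h
  exact h.preservesSectors

/-- `H_L(U,g)` conserves `N↑` and `N↓`. [folklore] -/
theorem preservesSectors_seededH : PreservesSectors ((hubbardTorus 2 L 1 U - ((g / (L : ℝ) ^ 2 : ℝ) : ℂ) • ((pairField dWaveFormFactor L)ᴴ * pairField dWaveFormFactor L))) := by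
  have h1 := LiebThm1.preservesSectors_hamiltonian (fermionTorusGraph 2 L) 1 U
  have h2 := (preservesSectors_pairIntensity L).smul (-(((g / (L : ℝ) ^ 2 : ℝ) : ℂ)))
  have h3 : (hubbardTorus 2 L 1 U - ((g / (L : ℝ) ^ 2 : ℝ) : ℂ) • ((pairField dWaveFormFactor L)ᴴ * pairField dWaveFormFactor L)) =
      hubbardTorus 2 L 1 U + (-(((g / (L : ℝ) ^ 2 : ℝ) : ℂ))) • ((pairField dWaveFormFactor L)ᴴ * pairField dWaveFormFactor L) := by
    rw [neg_smul, ← sub_eq_add_neg]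
  rw [h3]
  exact h1.add h2

omit [NeZero L] in
/-- A nonzero vector of the `(n,n)` sector forces `n ≤ |Λ_L|`. [folklore] -/
theorem le_card_of_mem_szSector {n : ℕ} {ψ : Fock (Orb (FermionTorus 2 L))}
    (hψ : ψ ∈ szSector (Λ := FermionTorus 2 L) (2 * n) (0 : ℝ)) (hne : ψ ≠ 0) :
    n ≤ Fintype.card (FermionTorus 2 L) := by
  by_contra hlt
  have hlt' := not_le.mp hlt
  apply hne
  funext s
  refine (mem_szSector_two_mul_zero_iff n ψ).1 hψ s fun h => ?_
  have : (upPart s).card ≤ Fintype.card (FermionTorus 2 L) := Finset.card_le_univ _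
  omega

/-- **Sector ground states of the seeded Hamiltonian exist, and the sector energy is a variational
lower bound** (`sector_groundState` applied to the `(n,n)` coordinate sector; RUNG is never vacuous
for lack of ground states). Tasaki (2020) §2.2. [folklore] -/
theorem seeded_sector_groundState {n : ℕ} (hn : n ≤ Fintype.card (FermionTorus 2 L)) :
    (∃ ψ, IsGroundStateInSector ((hubbardTorus 2 L 1 U - ((g / (L : ℝ) ^ 2 : ℝ) : ℂ) • ((pairField dWaveFormFactor L)ᴴ * pairField dWaveFormFactor L))) (2 * n) 0 ψ) ∧
      ∀ v ∈ szSector (Λ := FermionTorus 2 L) (2 * n) (0 : ℝ), star v ⬝ᵥ v = 1 →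
        ((hubbardTorus 2 L 1 U - ((g / (L : ℝ) ^ 2 : ℝ) : ℂ) • ((pairField dWaveFormFactor L)ᴴ * pairField dWaveFormFactor L))).minEnergyOn (szSector (2 * n) 0) ≤ (expect ((hubbardTorus 2 L 1 U - ((g / (L : ℝ) ^ 2 : ℝ) : ℂ) • ((pairField dWaveFormFactor L)ᴴ * pairField dWaveFormFactor L))) v).re := by
  classical
  obtain ⟨α₀, -, hα₀⟩ : ∃ α₀ : Finset (FermionTorus 2 L), α₀ ⊆ univ ∧ α₀.card = n :=
    Finset.exists_subset_card_eq (by rwa [Finset.card_univ])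
  have hp : ∃ s : Finset (Orb (FermionTorus 2 L)), (upPart s).card = n ∧ (downPart s).card = n :=
    ⟨pairSet α₀ α₀, by rw [upPart_pairSet, hα₀], by rw [downPart_pairSet, hα₀]⟩
  have hinv : ∀ s s' : Finset (Orb (FermionTorus 2 L)),
      ¬((upPart s).card = n ∧ (downPart s).card = n) →
      ((upPart s').card = n ∧ (downPart s').card = n) → (hubbardTorus 2 L 1 U - ((g / (L : ℝ) ^ 2 : ℝ) : ℂ) • ((pairField dWaveFormFactor L)ᴴ * pairField dWaveFormFactor L)) s s' = 0 := by
    intro s s' hs hs'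
    by_contra h
    have := preservesSectors_seededH U g L s s' h
    exact hs ⟨this.1.trans hs'.1, this.2.trans hs'.2⟩
  have hK : ∀ v : Fock (Orb (FermionTorus 2 L)), v ∈ szSector (2 * n) (0 : ℝ) ↔
      ∀ s, ¬((upPart s).card = n ∧ (downPart s).card = n) → v s = 0 :=
    fun v => mem_szSector_two_mul_zero_iff n v
  obtain ⟨⟨v, hv, hv0, hHv⟩, hb⟩ := sector_groundState ((hubbardTorus 2 L 1 U - ((g / (L : ℝ) ^ 2 : ℝ) : ℂ) • ((pairField dWaveFormFactor L)ᴴ * pairField dWaveFormFactor L)))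
    (seededH_isHermitian U g L) (fun s => (upPart s).card = n ∧ (downPart s).card = n)
    hp hinv (szSector (2 * n) 0) hK
  exact ⟨⟨v, hv, hv0, hHv⟩, hb⟩

/-- Normalised sector ground states of `H_L(U,g)` exist in every sector `(2n, 0)`, `n ≤ L²`. [folklore] -/
theorem exists_unit_groundState {n : ℕ} (hn : n ≤ Fintype.card (FermionTorus 2 L)) :
    ∃ ψ : Fock (Orb (FermionTorus 2 L)), star ψ ⬝ᵥ ψ = 1 ∧
      IsGroundStateInSector ((hubbardTorus 2 L 1 U - ((g / (L : ℝ) ^ 2 : ℝ) : ℂ) • ((pairField dWaveFormFactor L)ᴴ * pairField dWaveFormFactor L))) (2 * n) 0 ψ := by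
  obtain ⟨⟨ψ, hψ⟩, -⟩ := seeded_sector_groundState U g L hn
  obtain ⟨c, hc, hc1⟩ := exists_smul_unit hψ.2.1
  exact ⟨c • ψ, hc1, Summit.HubbardSuperconductivity.NoGo.isGroundStateInSector_smul _ _ _ hψ hc⟩

omit [NeZero L] in
/-- For a normalised sector ground state, `⟨ψ, H ψ⟩` is the sector energy. [folklore] -/
theorem expect_eq_of_groundState {H : Matrix (Finset (Orb (FermionTorus 2 L))) (Finset (Orb (FermionTorus 2 L))) ℂ}
    {N : ℕ} {M : ℝ} {ψ : Fock (Orb (FermionTorus 2 L))} (hψ1 : star ψ ⬝ᵥ ψ = 1)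
    (h : IsGroundStateInSector H N M ψ) :
    expect H ψ = ((H.minEnergyOn (szSector N M) : ℝ) : ℂ) := by
  rw [Literature.MathematicalPhysics.QuantumLattice.expect, h.2.2, dotProduct_smul, hψ1, smul_eq_mul, mul_one]

/-- Seeds differ by a multiple of `P_L`: `H(g') = H(g) − ((g'−g)/L²) P_L`. [folklore] -/
theorem seededH_eq_sub (g' : ℝ) :
    (hubbardTorus 2 L 1 U - ((g' / (L : ℝ) ^ 2 : ℝ) : ℂ) • ((pairField dWaveFormFactor L)ᴴ * pairField dWaveFormFactor L)) = (hubbardTorus 2 L 1 U - ((g / (L : ℝ) ^ 2 : ℝ) : ℂ) • ((pairField dWaveFormFactor L)ᴴ * pairField dWaveFormFactor L)) - (((g' - g) / (L : ℝ) ^ 2 : ℝ) : ℂ) • ((pairField dWaveFormFactor L)ᴴ * pairField dWaveFormFactor L) := by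
  rw [sub_sub, ← add_smul]
  congr 2
  push_cast
  ring

omit [NeZero L] in
/-- `⟨ψ,(A − B)ψ⟩ = ⟨ψ,Aψ⟩ − ⟨ψ,Bψ⟩`. [folklore] -/
theorem expect_sub' (A B : Matrix (Finset (Orb (FermionTorus 2 L))) (Finset (Orb (FermionTorus 2 L))) ℂ)
    (ψ : Fock (Orb (FermionTorus 2 L))) : expect (A - B) ψ = expect A ψ - expect B ψ := by
  simp [Literature.MathematicalPhysics.QuantumLattice.expect, sub_mulVec, dotProduct_sub]

/-- `re ⟨ψ, H(g')ψ⟩ = re ⟨ψ, H(g)ψ⟩ − ((g'−g)/L²) re ⟨ψ, P_L ψ⟩`. [folklore] -/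
theorem expect_seededH_re (g' : ℝ) (ψ : Fock (Orb (FermionTorus 2 L))) :
    (expect ((hubbardTorus 2 L 1 U - ((g' / (L : ℝ) ^ 2 : ℝ) : ℂ) • ((pairField dWaveFormFactor L)ᴴ * pairField dWaveFormFactor L))) ψ).re =
      (expect ((hubbardTorus 2 L 1 U - ((g / (L : ℝ) ^ 2 : ℝ) : ℂ) • ((pairField dWaveFormFactor L)ᴴ * pairField dWaveFormFactor L))) ψ).re - (g' - g) / (L : ℝ) ^ 2 * (expect (((pairField dWaveFormFactor L)ᴴ * pairField dWaveFormFactor L)) ψ).re := by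
  rw [seededH_eq_sub U g L g', expect_sub', expect_smul, Complex.sub_re, Complex.re_ofReal_mul]

/-- At `g = 0` the seeded Hamiltonian is the pure Hubbard torus. [folklore] -/
theorem seededH_zero : (hubbardTorus 2 L 1 U - ((0 / (L : ℝ) ^ 2 : ℝ) : ℂ) • ((pairField dWaveFormFactor L)ᴴ * pairField dWaveFormFactor L)) = hubbardTorus 2 L 1 U := by
  simp only [zero_div, Complex.ofReal_zero, zero_smul, sub_zero]

end Seeded

/-- **Every ground state at a larger seed carries at least the pair intensity of every ground state
at a smaller seed** (sum of the two variational inequalities; exact at finite `L`).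
[folklore] -/
theorem expect_pairIntensity_mono {U : ℝ} {L : ℕ} [NeZero L] {n : ℕ} {g₁ g₂ : ℝ} (hg : g₁ < g₂)
    {ψ₁ ψ₂ : Fock (Orb (FermionTorus 2 L))} (h₁u : star ψ₁ ⬝ᵥ ψ₁ = 1) (h₂u : star ψ₂ ⬝ᵥ ψ₂ = 1)
    (h₁ : IsGroundStateInSector ((hubbardTorus 2 L 1 U - ((g₁ / (L : ℝ) ^ 2 : ℝ) : ℂ) • ((pairField dWaveFormFactor L)ᴴ * pairField dWaveFormFactor L))) (2 * n) 0 ψ₁)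
    (h₂ : IsGroundStateInSector ((hubbardTorus 2 L 1 U - ((g₂ / (L : ℝ) ^ 2 : ℝ) : ℂ) • ((pairField dWaveFormFactor L)ᴴ * pairField dWaveFormFactor L))) (2 * n) 0 ψ₂) :
    (expect (((pairField dWaveFormFactor L)ᴴ * pairField dWaveFormFactor L)) ψ₁).re ≤ (expect (((pairField dWaveFormFactor L)ᴴ * pairField dWaveFormFactor L)) ψ₂).re := by
  have hn : n ≤ Fintype.card (FermionTorus 2 L) := le_card_of_mem_szSector L h₁.1 h₁.2.1
  obtain ⟨-, hb₁⟩ := seeded_sector_groundState U g₁ L hn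
  obtain ⟨-, hb₂⟩ := seeded_sector_groundState U g₂ L hn
  have e₁ : (expect ((hubbardTorus 2 L 1 U - ((g₁ / (L : ℝ) ^ 2 : ℝ) : ℂ) • ((pairField dWaveFormFactor L)ᴴ * pairField dWaveFormFactor L))) ψ₁).re = ((hubbardTorus 2 L 1 U - ((g₁ / (L : ℝ) ^ 2 : ℝ) : ℂ) • ((pairField dWaveFormFactor L)ᴴ * pairField dWaveFormFactor L))).minEnergyOn (szSector (2 * n) 0) := by
    rw [expect_eq_of_groundState L h₁u h₁, Complex.ofReal_re]
  have e₂ : (expect ((hubbardTorus 2 L 1 U - ((g₂ / (L : ℝ) ^ 2 : ℝ) : ℂ) • ((pairField dWaveFormFactor L)ᴴ * pairField dWaveFormFactor L))) ψ₂).re = ((hubbardTorus 2 L 1 U - ((g₂ / (L : ℝ) ^ 2 : ℝ) : ℂ) • ((pairField dWaveFormFactor L)ᴴ * pairField dWaveFormFactor L))).minEnergyOn (szSector (2 * n) 0) := by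
    rw [expect_eq_of_groundState L h₂u h₂, Complex.ofReal_re]
  have v₁ : ((hubbardTorus 2 L 1 U - ((g₁ / (L : ℝ) ^ 2 : ℝ) : ℂ) • ((pairField dWaveFormFactor L)ᴴ * pairField dWaveFormFactor L))).minEnergyOn (szSector (2 * n) 0) ≤ (expect ((hubbardTorus 2 L 1 U - ((g₁ / (L : ℝ) ^ 2 : ℝ) : ℂ) • ((pairField dWaveFormFactor L)ᴴ * pairField dWaveFormFactor L))) ψ₂).re :=
    hb₁ ψ₂ h₂.1 h₂u
  have v₂ : ((hubbardTorus 2 L 1 U - ((g₂ / (L : ℝ) ^ 2 : ℝ) : ℂ) • ((pairField dWaveFormFactor L)ᴴ * pairField dWaveFormFactor L))).minEnergyOn (szSector (2 * n) 0) ≤ (expect ((hubbardTorus 2 L 1 U - ((g₂ / (L : ℝ) ^ 2 : ℝ) : ℂ) • ((pairField dWaveFormFactor L)ᴴ * pairField dWaveFormFactor L))) ψ₁).re :=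
    hb₂ ψ₁ h₁.1 h₁u
  have r₁ := expect_seededH_re U g₁ L g₂ ψ₁
  have r₂ := expect_seededH_re U g₁ L g₂ ψ₂
  have hL : (0 : ℝ) < (L : ℝ) ^ 2 := by
    have := NeZero.pos L
    positivity
  have hc : 0 < (g₂ - g₁) / (L : ℝ) ^ 2 := div_pos (sub_pos.2 hg) hL
  have key : (g₂ - g₁) / (L : ℝ) ^ 2 * (expect (((pairField dWaveFormFactor L)ᴴ * pairField dWaveFormFactor L)) ψ₁).re ≤
      (g₂ - g₁) / (L : ℝ) ^ 2 * (expect (((pairField dWaveFormFactor L)ᴴ * pairField dWaveFormFactor L)) ψ₂).re := by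
    linarith
  exact le_of_mul_le_mul_left key hc


/-- **Left chord ≤ order** (the RUNG chord): for `g' < g` and every normalised sector GS `ψ` of
`H_L(U,g)`, `E_L(g') − E_L(g) ≤ ((g − g')/L²)·re⟨ψ,P_Lψ⟩`. [folklore] -/
theorem leftChord_le_order {U g g' : ℝ} {L : ℕ} [NeZero L] {n : ℕ} (hg : g' < g)
    {ψ : Fock (Orb (FermionTorus 2 L))} (hψ : star ψ ⬝ᵥ ψ = 1)
    (hgs : IsGroundStateInSector ((hubbardTorus 2 L 1 U - ((g / (L : ℝ) ^ 2 : ℝ) : ℂ) • ((pairField dWaveFormFactor L)ᴴ * pairField dWaveFormFactor L))) (2 * n) 0 ψ) :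
    (Matrix.minEnergyOn (hubbardTorus 2 L 1 U - ((g' / (L : ℝ) ^ 2 : ℝ) : ℂ) • ((pairField dWaveFormFactor L)ᴴ * pairField dWaveFormFactor L)) (szSector (2 * n) 0)) - (Matrix.minEnergyOn (hubbardTorus 2 L 1 U - ((g / (L : ℝ) ^ 2 : ℝ) : ℂ) • ((pairField dWaveFormFactor L)ᴴ * pairField dWaveFormFactor L)) (szSector (2 * n) 0)) ≤
      (g - g') / (L : ℝ) ^ 2 * (expect (((pairField dWaveFormFactor L)ᴴ * pairField dWaveFormFactor L)) ψ).re := by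
  have hn := le_card_of_mem_szSector L hgs.1 hgs.2.1
  obtain ⟨-, hb⟩ := seeded_sector_groundState U g' L hn
  have v : (Matrix.minEnergyOn (hubbardTorus 2 L 1 U - ((g' / (L : ℝ) ^ 2 : ℝ) : ℂ) • ((pairField dWaveFormFactor L)ᴴ * pairField dWaveFormFactor L)) (szSector (2 * n) 0)) ≤ (expect ((hubbardTorus 2 L 1 U - ((g' / (L : ℝ) ^ 2 : ℝ) : ℂ) • ((pairField dWaveFormFactor L)ᴴ * pairField dWaveFormFactor L))) ψ).re := hb ψ hgs.1 hψ
  have e : (expect ((hubbardTorus 2 L 1 U - ((g / (L : ℝ) ^ 2 : ℝ) : ℂ) • ((pairField dWaveFormFactor L)ᴴ * pairField dWaveFormFactor L))) ψ).re = (Matrix.minEnergyOn (hubbardTorus 2 L 1 U - ((g / (L : ℝ) ^ 2 : ℝ) : ℂ) • ((pairField dWaveFormFactor L)ᴴ * pairField dWaveFormFactor L)) (szSector (2 * n) 0)) := by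
    rw [expect_eq_of_groundState L hψ hgs, Complex.ofReal_re]
  have r := expect_seededH_re U g L g' ψ
  have _unused := hg
  have : (g - g') / (L : ℝ) ^ 2 * (expect (((pairField dWaveFormFactor L)ᴴ * pairField dWaveFormFactor L)) ψ).re =
      -((g' - g) / (L : ℝ) ^ 2 * (expect (((pairField dWaveFormFactor L)ᴴ * pairField dWaveFormFactor L)) ψ).re) := by ring
  linarith

/-- **Order ≤ right chord** (the CEILING chord): for `g < g''` and every normalised sector GS `ψ`
of `H_L(U,g)`, `((g'' − g)/L²)·re⟨ψ,P_Lψ⟩ ≤ E_L(g) − E_L(g'')`. [folklore] -/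
theorem order_le_rightChord {U g g'' : ℝ} {L : ℕ} [NeZero L] {n : ℕ} (hg : g < g'')
    {ψ : Fock (Orb (FermionTorus 2 L))} (hψ : star ψ ⬝ᵥ ψ = 1)
    (hgs : IsGroundStateInSector ((hubbardTorus 2 L 1 U - ((g / (L : ℝ) ^ 2 : ℝ) : ℂ) • ((pairField dWaveFormFactor L)ᴴ * pairField dWaveFormFactor L))) (2 * n) 0 ψ) :
    (g'' - g) / (L : ℝ) ^ 2 * (expect (((pairField dWaveFormFactor L)ᴴ * pairField dWaveFormFactor L)) ψ).re ≤
      (Matrix.minEnergyOn (hubbardTorus 2 L 1 U - ((g / (L : ℝ) ^ 2 : ℝ) : ℂ) • ((pairField dWaveFormFactor L)ᴴ * pairField dWaveFormFactor L)) (szSector (2 * n) 0)) - (Matrix.minEnergyOn (hubbardTorus 2 L 1 U - ((g'' / (L : ℝ) ^ 2 : ℝ) : ℂ) • ((pairField dWaveFormFactor L)ᴴ * pairField dWaveFormFactor L)) (szSector (2 * n) 0)) := by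
  have hn := le_card_of_mem_szSector L hgs.1 hgs.2.1
  obtain ⟨-, hb⟩ := seeded_sector_groundState U g'' L hn
  have v : (Matrix.minEnergyOn (hubbardTorus 2 L 1 U - ((g'' / (L : ℝ) ^ 2 : ℝ) : ℂ) • ((pairField dWaveFormFactor L)ᴴ * pairField dWaveFormFactor L)) (szSector (2 * n) 0)) ≤ (expect ((hubbardTorus 2 L 1 U - ((g'' / (L : ℝ) ^ 2 : ℝ) : ℂ) • ((pairField dWaveFormFactor L)ᴴ * pairField dWaveFormFactor L))) ψ).re := hb ψ hgs.1 hψ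
  have e : (expect ((hubbardTorus 2 L 1 U - ((g / (L : ℝ) ^ 2 : ℝ) : ℂ) • ((pairField dWaveFormFactor L)ᴴ * pairField dWaveFormFactor L))) ψ).re = (Matrix.minEnergyOn (hubbardTorus 2 L 1 U - ((g / (L : ℝ) ^ 2 : ℝ) : ℂ) • ((pairField dWaveFormFactor L)ᴴ * pairField dWaveFormFactor L)) (szSector (2 * n) 0)) := by
    rw [expect_eq_of_groundState L hψ hgs, Complex.ofReal_re]
  have r := expect_seededH_re U g L g'' ψ
  have _unused := hg
  linarith

/-- `g ↦ E_L(g)` is non-increasing (`P_L ≥ 0`). [folklore] -/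
theorem sectorEnergy_antitone {U : ℝ} {L : ℕ} [NeZero L] {n : ℕ} (hn : n ≤ Fintype.card (FermionTorus 2 L))
    {g g'' : ℝ} (hg : g ≤ g'') : (Matrix.minEnergyOn (hubbardTorus 2 L 1 U - ((g'' / (L : ℝ) ^ 2 : ℝ) : ℂ) • ((pairField dWaveFormFactor L)ᴴ * pairField dWaveFormFactor L)) (szSector (2 * n) 0)) ≤ (Matrix.minEnergyOn (hubbardTorus 2 L 1 U - ((g / (L : ℝ) ^ 2 : ℝ) : ℂ) • ((pairField dWaveFormFactor L)ᴴ * pairField dWaveFormFactor L)) (szSector (2 * n) 0)) := by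
  rcases eq_or_lt_of_le hg with rfl | hlt
  · exact le_rfl
  obtain ⟨ψ, hψ, hgs⟩ := exists_unit_groundState U g L hn
  have h := order_le_rightChord hlt hψ hgs
  have hL : (0 : ℝ) < (L : ℝ) ^ 2 := by
    have := NeZero.pos L
    positivity
  have : 0 ≤ (g'' - g) / (L : ℝ) ^ 2 * (expect (((pairField dWaveFormFactor L)ᴴ * pairField dWaveFormFactor L)) ψ).re :=
    mul_nonneg (div_nonneg (sub_nonneg.2 hg) hL.le) (expect_pairIntensity_nonneg L ψ)
  linarith

/-- `g ↦ E_L(g)` is midpoint-concave along chords: for `g' < g < g''`,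
`(E(g') − E(g))/(g − g') ≤ (E(g) − E(g''))/(g'' − g)` (both pinch the order at `g`). [folklore] -/
theorem chord_slope_mono {U g' g g'' : ℝ} {L : ℕ} [NeZero L] {n : ℕ}
    (hn : n ≤ Fintype.card (FermionTorus 2 L)) (h₁ : g' < g) (h₂ : g < g'') :
    ((Matrix.minEnergyOn (hubbardTorus 2 L 1 U - ((g' / (L : ℝ) ^ 2 : ℝ) : ℂ) • ((pairField dWaveFormFactor L)ᴴ * pairField dWaveFormFactor L)) (szSector (2 * n) 0)) - (Matrix.minEnergyOn (hubbardTorus 2 L 1 U - ((g / (L : ℝ) ^ 2 : ℝ) : ℂ) • ((pairField dWaveFormFactor L)ᴴ * pairField dWaveFormFactor L)) (szSector (2 * n) 0))) / (g - g') ≤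
      ((Matrix.minEnergyOn (hubbardTorus 2 L 1 U - ((g / (L : ℝ) ^ 2 : ℝ) : ℂ) • ((pairField dWaveFormFactor L)ᴴ * pairField dWaveFormFactor L)) (szSector (2 * n) 0)) - (Matrix.minEnergyOn (hubbardTorus 2 L 1 U - ((g'' / (L : ℝ) ^ 2 : ℝ) : ℂ) • ((pairField dWaveFormFactor L)ᴴ * pairField dWaveFormFactor L)) (szSector (2 * n) 0))) / (g'' - g) := by
  obtain ⟨ψ, hψ, hgs⟩ := exists_unit_groundState U g L hn
  have hl := leftChord_le_order h₁ hψ hgs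
  have hr := order_le_rightChord h₂ hψ hgs
  have hL : (0 : ℝ) < (L : ℝ) ^ 2 := by
    have := NeZero.pos L
    positivity
  set P := (expect (((pairField dWaveFormFactor L)ᴴ * pairField dWaveFormFactor L)) ψ).re
  have hP : ((Matrix.minEnergyOn (hubbardTorus 2 L 1 U - ((g' / (L : ℝ) ^ 2 : ℝ) : ℂ) • ((pairField dWaveFormFactor L)ᴴ * pairField dWaveFormFactor L)) (szSector (2 * n) 0)) - (Matrix.minEnergyOn (hubbardTorus 2 L 1 U - ((g / (L : ℝ) ^ 2 : ℝ) : ℂ) • ((pairField dWaveFormFactor L)ᴴ * pairField dWaveFormFactor L)) (szSector (2 * n) 0))) / (g - g') ≤ P / (L : ℝ) ^ 2 := by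
    rw [div_le_iff₀ (sub_pos.2 h₁)]
    calc (Matrix.minEnergyOn (hubbardTorus 2 L 1 U - ((g' / (L : ℝ) ^ 2 : ℝ) : ℂ) • ((pairField dWaveFormFactor L)ᴴ * pairField dWaveFormFactor L)) (szSector (2 * n) 0)) - (Matrix.minEnergyOn (hubbardTorus 2 L 1 U - ((g / (L : ℝ) ^ 2 : ℝ) : ℂ) • ((pairField dWaveFormFactor L)ᴴ * pairField dWaveFormFactor L)) (szSector (2 * n) 0)) ≤ (g - g') / (L : ℝ) ^ 2 * P := hl
      _ = P / (L : ℝ) ^ 2 * (g - g') := by ring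
  have hQ : P / (L : ℝ) ^ 2 ≤ ((Matrix.minEnergyOn (hubbardTorus 2 L 1 U - ((g / (L : ℝ) ^ 2 : ℝ) : ℂ) • ((pairField dWaveFormFactor L)ᴴ * pairField dWaveFormFactor L)) (szSector (2 * n) 0)) - (Matrix.minEnergyOn (hubbardTorus 2 L 1 U - ((g'' / (L : ℝ) ^ 2 : ℝ) : ℂ) • ((pairField dWaveFormFactor L)ᴴ * pairField dWaveFormFactor L)) (szSector (2 * n) 0))) / (g'' - g) := by
    rw [le_div_iff₀ (sub_pos.2 h₂)]
    calc P / (L : ℝ) ^ 2 * (g'' - g) = (g'' - g) / (L : ℝ) ^ 2 * P := by ring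
      _ ≤ (Matrix.minEnergyOn (hubbardTorus 2 L 1 U - ((g / (L : ℝ) ^ 2 : ℝ) : ℂ) • ((pairField dWaveFormFactor L)ᴴ * pairField dWaveFormFactor L)) (szSector (2 * n) 0)) - (Matrix.minEnergyOn (hubbardTorus 2 L 1 U - ((g'' / (L : ℝ) ^ 2 : ℝ) : ℂ) • ((pairField dWaveFormFactor L)ᴴ * pairField dWaveFormFactor L)) (szSector (2 * n) 0)) := hr
  exact hP.trans hQ


end Summit.HubbardSuperconductivity.TwTipContinuation.Negative
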